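import Literature.NumberTheory.EllipticCurves.Sprung2012.ColemanMapTheorems
import Literature.NumberTheory.EllipticCurves.Sprung2017.ChromaticLimit
import HarnessLib

/-!
# Sprung 2012, Proposition 5.7 (the Coleman value is unique) — DISCHARGE of the named fact
# `Sprung2012.prop57_isColemanPair_unique` from the tree's chromatic-limit uniqueness theorem

Topic `Literature/NumberTheory/EllipticCurves`, cluster `Sprung2012` (namespace = path). PROOF file
(theorems only, no definition, no named fact; net debt −1): the named fact
`prop57_isColemanPair_unique` of `Sprung2012/ColemanMapTheorems.lean` (cell `bsd-ssimc`, seat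
kdot-split: F. E. I. Sprung, J. Number Theory **132** (2012), **Proposition 5.7** (Limit Proposition,
p. 1494: "`lim←_n (Λ_n ⊕ Λ_n)/Ker h_n ≅ Λ ⊕ Λ`", via `⋂_n M_n = 0`, Lemma 5.8) in the unfolded form
"two Coleman values `(L♯, L♭)`, `(L♯', L♭')` of the same class `z` coincide") HOLDS: its docstring
already records that it is "pure `Λ`-algebra given `p ∣ a_p`; … provable in the tree in the manner of
`Sprung2017.IsChromaticLimit.unique`". Indeed `Sprung2012.IsColemanPair κ ι W ap g c z L♯ L♭`
(`ω_n ∣ P_{n,c_n}(z) + u_n L♯ + v_n L♭` for all `n`) IS `Sprung2017.IsChromaticLimit p ap Θ L♯ L♭`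
for the integral sequence `Θ_n :=` the polynomial `∑_{j<pⁿ} z(gʲ c_n)·(1+T)ʲ ∈ ℤ_p[T]` whose image in
`Λ` is the orbit sum `Sprung2012.pairingSum … g n (c n) z` (Def. 3.1), and
`Sprung2017.IsChromaticLimit.unique` (file `Sprung2017/ChromaticLimit.lean`, seat bsd-littype-11 g2:
the `𝔐`-adic limit argument of Sprung 2012 Prop. 5.7 / Lemma 5.8 = Sprung 2017 Thm. 1.12's
uniqueness, for ANY sequence `Θ`, hypothesis `p ∣ a_p`) gives `L♯ = L♯'`, `L♭ = L♭'`. Of the fact's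
standing hypotheses only `p ∣ a_p` (supersingularity) is used — as in print ("since `p` is
supersingular" is what makes `𝔐 = 0`). HONEST FRAMING (cross-ladder LITERATURE-TYPING layer
D-0088(4), cell `bsd-littype`, seat `bsd-littype-11` g3): a discharge; nothing about any curve is
asserted; no census cell moves; BSD is not proved by any of this.

## Contents
* `isChromaticLimit_of_isColemanPair` — the dictionary `IsColemanPair ⇒ IsChromaticLimit` for the
  polynomial lift `colemanTheta` of the pairing sequence (`coe_colemanTheta : ↑(Θ_n) = P_{n,c_n}(z)`);
* `IsColemanPair.unique` — two Coleman values of one class coincide (`p ∣ a_p`);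
* `prop57_isColemanPair_unique_holds : prop57_isColemanPair_unique`.

## References
* [Sprung2012] Prop. 5.7, Lemma 5.8 (pp. 1494–1495); Def. 3.1 (p. 1489); Def. 5.9 (p. 1495).
* [Sprung2017] F. Sprung, ANT 11 (2017), Thm. 1.12 (uniqueness) and "Proposition (`𝔐 = 0`)".
-/

noncomputable section

open scoped Classical NumberField

open NumberField IsDedekindDomain Polynomial WeierstrassCurve Literature.NumberTheory.EllipticCurves
  Literature.NumberTheory.EllipticCurves.ZpExtension Literature.NumberTheory.EllipticCurves.Sprung2017

universe u

namespace Literature.NumberTheory.EllipticCurves.Sprung2012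

section Dictionary

variable {K : Type u} [Field K] {p : ℕ} [Fact p.Prime] (κ : ZpExtension K p)
variable {E : Type u} [Field E] [Algebra K E] (ι : AlgebraicClosure K →ₐ[K] AlgebraicClosure E)
variable (W : WeierstrassCurve K)

/-- The POLYNOMIAL lift `Θ_n = ∑_{j<pⁿ} z(gʲ•c_n)·(1+T)ʲ ∈ ℤ_p[T]` of Sprung's pairing value
`P_{n,c_n}(z)` (Def. 3.1; its image in `Λ` is `pairingSum … g n (c n) z`, `coe_colemanTheta`).
[cite: Sprung2012, Def. 3.1 (p. 1489)] -/
def colemanTheta (g : Field.absoluteGaloisGroup E) (c : ℕ → localPoints W E)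
    (z : localTowerPointsOfEmb κ ι W →+ ℤ_[p]) (n : ℕ) : ℤ_[p][X] :=
  ∑ j ∈ Finset.range (p ^ n),
    Polynomial.C (evalOn W (localTowerPointsOfEmb κ ι W) z (g ^ j • c n)) * (1 + Polynomial.X) ^ j

/-- `↑(Θ_n) = P_{n,c_n}(z)` in `Λ = ℤ_p⟦T⟧`. [cite: Sprung2012, Def. 3.1 (p. 1489)] -/
theorem coe_colemanTheta (g : Field.absoluteGaloisGroup E) (c : ℕ → localPoints W E)
    (z : localTowerPointsOfEmb κ ι W →+ ℤ_[p]) (n : ℕ) :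
    ((colemanTheta κ ι W g c z n : ℤ_[p][X]) : PowerSeries ℤ_[p]) =
      pairingSum W (localTowerPointsOfEmb κ ι W) g n (c n) z := by
  rw [colemanTheta, pairingSum_def, ← Polynomial.coeToPowerSeries.ringHom_apply, map_sum]
  refine Finset.sum_congr rfl fun j _ => ?_
  rw [Polynomial.coeToPowerSeries.ringHom_apply, Polynomial.coe_mul, Polynomial.coe_pow,
    Polynomial.coe_add, Polynomial.coe_one, Polynomial.coe_C, Polynomial.coe_X]

/-- **`IsColemanPair ⇒ IsChromaticLimit`**: a Coleman value `(L♯, L♭)` of `z` (Sprung 2012 Def. 5.9 /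
7.1 unfolded: `ω_n ∣ P_{n,c_n}(z) + u_n L♯ + v_n L♭`) is a chromatic limit of the integral sequence
`(Θ_n)_n = (P_{n,c_n}(z))_n` in the sense of `Sprung2017.IsChromaticLimit`.
[cite: Sprung2012, Def. 5.9 (p. 1495)] [cite: Sprung2017, Cor. 4.4] -/
theorem isChromaticLimit_of_isColemanPair {ap : ℤ} {g : Field.absoluteGaloisGroup E}
    {c : ℕ → localPoints W E} {z : localTowerPointsOfEmb κ ι W →+ ℤ_[p]}
    {Lsharp Lflat : IwasawaAlgebra p} (h : IsColemanPair κ ι W ap g c z Lsharp Lflat) :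
    IsChromaticLimit p ap (colemanTheta κ ι W g c z) Lsharp Lflat := by
  intro m
  obtain ⟨Q, hQ⟩ := h m
  refine ⟨Q, ?_⟩
  rw [coe_colemanTheta]
  exact hQ

/-- **Two Coleman values of one class coincide** (`p ∣ a_p`): Sprung 2012 Prop. 5.7 in the unfolded
form, from `Sprung2017.IsChromaticLimit.unique`. [cite: Sprung2012, Prop. 5.7 and Lemma 5.8 (pp. 1494–1495)] -/
theorem IsColemanPair.unique {ap : ℤ} (hap : (p : ℤ) ∣ ap) {g : Field.absoluteGaloisGroup E}
    {c : ℕ → localPoints W E} {z : localTowerPointsOfEmb κ ι W →+ ℤ_[p]}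
    {Lsharp Lflat Lsharp' Lflat' : IwasawaAlgebra p}
    (h : IsColemanPair κ ι W ap g c z Lsharp Lflat) (h' : IsColemanPair κ ι W ap g c z Lsharp' Lflat') :
    Lsharp = Lsharp' ∧ Lflat = Lflat' :=
  IsChromaticLimit.unique hap (isChromaticLimit_of_isColemanPair κ ι W h)
    (isChromaticLimit_of_isColemanPair κ ι W h')

end Dictionary

/-- **DISCHARGE of `prop57_isColemanPair_unique` (Sprung 2012 Prop. 5.7, Limit Proposition).** Of the
fact's hypotheses only `p ∣ a_p` is used. [cite: Sprung2012, Prop. 5.7 and Lemma 5.8 (pp. 1494–1495)] -/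
theorem prop57_isColemanPair_unique_holds : prop57_isColemanPair_unique := by
  intro W _ _ p _ _ _ hap κ γ _ _ _ v _ g _ cneg c _ z Lsharp Lflat Lsharp' Lflat' h h'
  exact IsColemanPair.unique κ (closureEmb (K := ℚ) (v.adicCompletion ℚ)) W hap h h'

end Literature.NumberTheory.EllipticCurves.Sprung2012

end
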